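import Summits.CriticalPhenomena.PercolationContinuityZ3.Theorems.PercNearOneGluingNoHeavyLowerTailSahiHittingPercolationAllOrders
import Summits.CriticalPhenomena.PercolationContinuityZ3.Theorems.PercNearOneGluingNoHeavyLowerTailSahiHittingAnyIndexFour
import HarnessLib

/-!
# `NoHeavyLowerTail` (stmt-CriticalPhenomena-4575) — bond percolation on ANY graph, EVERY order: edge-set families of width ≤ 4 and
# four edge sets with arbitrary multiplicities (computational)

Support file, seat `prim-l12-p5` (gen 7), `--supports stmt-CriticalPhenomena-4575`, COMPUTATIONAL (through the kernel certificate `hit4_check` of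
the hitting `C₄`, inherited via `…SahiHittingAnyIndexFour`).  No definitions, no named facts, no sorries.  Companion of the standard-axiom file
`…SahiHittingPercolationAllOrders` (width ≤ 3).

* `msahiE_prodBernoulli_someClosed_nonneg_of_width_le_four` — decreasing form on any index type, width ≤ 4.
* `setBernoulli_msahiE_hit_nonneg_of_width_le_four` / `…someClosed…` — Mathlib's `setBer(u, p)`.
* **`msahiE_bondPercolation_someOpen_nonneg_of_width_le_four`** / **`…someClosed…`** — `P_p` on any graph, finite edge sets `F : Fin m → Finset (Sym2 V)`
  with a nested pair among any five indices: `E_m ≥ 0` for the events "some edge of `F_l` open" (resp. closed), every `m`.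
* **`msahiE_bondPercolation_someOpen_nonneg_of_four_sets`** / `…someClosed_nonneg_of_four_sets` — any FOUR finite edge sets with arbitrary
  multiplicities: every coefficient of Sahi's generating function (Conjecture 4 of [Sahi2008] / 1.2 of [LiebSahi2021]) of the four events
  "some edge of `B_i` is open" (resp. "closed") is nonnegative, on any graph.
-/

noncomputable section

namespace Summit.CriticalPhenomena.PercolationContinuityZ3.Theorems

namespace SahiHitting

open MeasureTheory ProbabilityTheory Finset Function Literature.Combinatorics.Sahi2008
open Literature.Probability.Percolation (bondPercolation BondConfig)
open Literature.Probability.Percolation.DecisionTree (ind ind_of_mem ind_of_not_mem ind_nonneg)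
open Literature.Probability.LatticeModels (prodBernoulli prodBernoulli_indicator_holds)

variable {ι : Type*}

/-- **Decreasing form, width ≤ 4, ANY product space, every order** (computational). [this work] -/
theorem msahiE_prodBernoulli_someClosed_nonneg_of_width_le_four (q : ι → unitInterval) (m : ℕ) (A : Fin m → Finset ι)
    (hw : ∀ S : Finset (Fin m), S.card = 5 → ∃ i ∈ S, ∃ j ∈ S, i ≠ j ∧ A i ⊆ A j) :
    0 ≤ msahiE (prodBernoulli q) m (fun l => ind {ω : Set ι | ∃ a ∈ A l, a ∉ ω}) := by
  classical
  let K : Finset ι := Finset.univ.biUnion A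
  have hA : ∀ l, A l ⊆ K := fun l => Finset.subset_biUnion_of_mem A (Finset.mem_univ l)
  rw [msahiE_prodBernoulli_someClosed_eq_sahiE q K m A hA]
  refine prodBernoulli_sahiE_someClosed_nonneg_of_width_le_four _ m _ fun S hS => ?_
  obtain ⟨i, hi, j, hj, hij, hsub⟩ := hw S hS
  exact ⟨i, hi, j, hj, hij, subtype_subset_subtype_of_subset hsub⟩

/-- **`setBer(u, p)` form, hitting events, width ≤ 4, every order** (computational). [this work; cite: Grimmett1999, §1.3] -/
theorem setBernoulli_msahiE_hit_nonneg_of_width_le_four (u : Set ι) (p : unitInterval) (m : ℕ) (A : Fin m → Finset ι)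
    (hw : ∀ S : Finset (Fin m), S.card = 5 → ∃ i ∈ S, ∃ j ∈ S, i ≠ j ∧ A i ⊆ A j) :
    0 ≤ msahiE setBer(u, p) m (fun l => ind {ω : Set ι | ∃ a ∈ A l, a ∈ ω}) := by
  classical
  rw [← prodBernoulli_indicator_holds u p]
  exact msahiE_prodBernoulli_hit_nonneg_of_width_le_four _ m A hw

/-- **`setBer(u, p)` form, "some coordinate closed", width ≤ 4, every order** (computational). [this work; cite: Grimmett1999, §1.3] -/
theorem setBernoulli_msahiE_someClosed_nonneg_of_width_le_four (u : Set ι) (p : unitInterval) (m : ℕ) (A : Fin m → Finset ι)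
    (hw : ∀ S : Finset (Fin m), S.card = 5 → ∃ i ∈ S, ∃ j ∈ S, i ≠ j ∧ A i ⊆ A j) :
    0 ≤ msahiE setBer(u, p) m (fun l => ind {ω : Set ι | ∃ a ∈ A l, a ∉ ω}) := by
  classical
  rw [← prodBernoulli_indicator_holds u p]
  exact msahiE_prodBernoulli_someClosed_nonneg_of_width_le_four _ m A hw

variable {V : Type*}

/-- **Bond percolation on ANY graph, every order, width ≤ 4: `0 ≤ E_m({some edge of F_l open}_l)`** (computational).
[this work; cite: Kahn2022, Conj. 5 (arXiv p. 3); Grimmett1999, §1.3] -/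
theorem msahiE_bondPercolation_someOpen_nonneg_of_width_le_four (G : SimpleGraph V) (p : unitInterval) (m : ℕ)
    (F : Fin m → Finset (Sym2 V)) (hw : ∀ S : Finset (Fin m), S.card = 5 → ∃ i ∈ S, ∃ j ∈ S, i ≠ j ∧ F i ⊆ F j) :
    0 ≤ msahiE (bondPercolation G p) m (fun l => ind {ω : BondConfig V | ∃ e ∈ F l, e ∈ ω}) := by
  unfold bondPercolation
  exact setBernoulli_msahiE_hit_nonneg_of_width_le_four _ p m F hw

/-- **Bond percolation on ANY graph, every order, width ≤ 4, decreasing form: `0 ≤ E_m({some edge of F_l closed}_l)`** (computational).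
[this work; cite: Kahn2022, Conj. 5 (arXiv p. 3); GrimmettPercolation1999, §11.2] -/
theorem msahiE_bondPercolation_someClosed_nonneg_of_width_le_four (G : SimpleGraph V) (p : unitInterval) (m : ℕ)
    (F : Fin m → Finset (Sym2 V)) (hw : ∀ S : Finset (Fin m), S.card = 5 → ∃ i ∈ S, ∃ j ∈ S, i ≠ j ∧ F i ⊆ F j) :
    0 ≤ msahiE (bondPercolation G p) m (fun l => ind {ω : BondConfig V | ∃ e ∈ F l, e ∉ ω}) := by
  unfold bondPercolation
  exact setBernoulli_msahiE_someClosed_nonneg_of_width_le_four _ p m F hw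

/-- **Four finite edge sets, arbitrary multiplicities, every order, any graph** (computational): for `B : Fin 4 → Finset (Sym2 V)` and any
`c : Fin m → Fin 4`, `0 ≤ E_m({some edge of B_{c l} open}_l)` under `P_p` — Sahi's generating-function conjecture for the four events
"some edge of `B_i` is open". [this work; cite: Kahn2022, Conj. 5 (arXiv p. 3)] -/
theorem msahiE_bondPercolation_someOpen_nonneg_of_four_sets (G : SimpleGraph V) (p : unitInterval) (B : Fin 4 → Finset (Sym2 V))
    (m : ℕ) (c : Fin m → Fin 4) :
    0 ≤ msahiE (bondPercolation G p) m (fun l => ind {ω : BondConfig V | ∃ e ∈ B (c l), e ∈ ω}) := by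
  refine msahiE_bondPercolation_someOpen_nonneg_of_width_le_four G p m (fun l => B (c l)) fun S hS => ?_
  have hlt : (Finset.univ : Finset (Fin 4)).card < S.card := by simp [hS]
  obtain ⟨i, hi, j, hj, hij, hc⟩ := Finset.exists_ne_map_eq_of_card_lt_of_maps_to hlt (f := c) fun _ _ => Finset.mem_univ _
  exact ⟨i, hi, j, hj, hij, by simp [hc]⟩

/-- **Four finite edge sets, arbitrary multiplicities, every order, any graph, decreasing form** (computational): the events
"some edge of `B_{c l}` is closed". [this work; cite: Kahn2022, Conj. 5 (arXiv p. 3)] -/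
theorem msahiE_bondPercolation_someClosed_nonneg_of_four_sets (G : SimpleGraph V) (p : unitInterval) (B : Fin 4 → Finset (Sym2 V))
    (m : ℕ) (c : Fin m → Fin 4) :
    0 ≤ msahiE (bondPercolation G p) m (fun l => ind {ω : BondConfig V | ∃ e ∈ B (c l), e ∉ ω}) := by
  refine msahiE_bondPercolation_someClosed_nonneg_of_width_le_four G p m (fun l => B (c l)) fun S hS => ?_
  have hlt : (Finset.univ : Finset (Fin 4)).card < S.card := by simp [hS]
  obtain ⟨i, hi, j, hj, hij, hc⟩ := Finset.exists_ne_map_eq_of_card_lt_of_maps_to hlt (f := c) fun _ _ => Finset.mem_univ _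
  exact ⟨i, hi, j, hj, hij, by simp [hc]⟩

end SahiHitting

end Summit.CriticalPhenomena.PercolationContinuityZ3.Theorems
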